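import Literature.AlgebraicGeometry.Kawanoue2007.IdealisticFiltration
import Mathlib.Algebra.BigOperators.Finsupp.Basic
import HarnessLib

/-!
# Kawanoue 2007, Part I, Lemma 2.2.1.2 (1): the explicit levels of the idealistic filtration `G(T)` generated by `T`

H. Kawanoue, *Toward resolution of singularities over a field of positive characteristic. Part I.
Foundation; the language of the idealistic filtration*, Publ. RIMS **43** (2007) 819–909
(= arXiv:math/0607009) [Kawanoue2007]. Sequel of `IdealisticFiltration.lean` (`generate T = G(T)`,
the minimal idealistic filtration containing `T ⊂ R × ℝ`, Def. 2.1.1.1 (3)). This file PROVES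

> **Lemma 2.2.1.2 (1).** «Let `𝕀` be an idealistic filtration generated by `T = {(f_λ, a_λ)} ⊂ R × ℝ`,
> i.e., `𝕀 = G(T)`. Define a subset `𝕀' ⊂ R × ℝ` by setting
> `𝕀'_a = ( ∏ f_λ^{n_λ} ; n_λ ∈ ℤ_{≥0}, Σ n_λ a_λ ≥ a )`, `a ∈ ℝ`.
> Then `𝕀'` is an idealistic filtration, and `𝕀' = 𝕀`.»

for an arbitrary commutative ring `R` (the printed setting is the coordinate ring of a smooth affine
variety, its localization or completion; nothing of that is used). Exponent vectors `(n_λ)` are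
finitely supported functions `n : (R × ℝ) →₀ ℕ` with support in `T`; `monomialOf n = ∏ f_λ^{n_λ}`,
`weightOf n = Σ n_λ a_λ`, `genMonomials T a` = the printed generating set of `𝕀'_a`, `generate' T = 𝕀'`;
the lemma is `generate'_eq_generate` / `level_generate_eq_span`. No named facts. Pages re-read on the
held arXiv text (`lit read paper:arxiv-math-0607009`, chunk p0055). Campaign `res-hironaka`
(D-0089), rung LIT-6. The printed convention for `T = ∅` («`G(∅) = ({0} × ℝ) ∪ (R × ℝ_{<0})`»,
p0055, at odds with condition (o) at level `0`) is not needed: here `G(∅)_a = R` for `a ≤ 0` and `= 0`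
for `a > 0` falls out of the general formula (`level_generate_empty_of_pos`).

Deliberately NOT here: Lemma 2.2.1.2 (2)(3) (explicit generators of the 𝔇-saturation through
Hasse–Schmidt derivatives w.r.t. a regular system of parameters, and of the ℜ-saturation).

## References

* H. Kawanoue, Publ. RIMS 43 (2007) 819–909 = arXiv:math/0607009: Lemma 2.2.1.2 (1). [Kawanoue2007]
-/

namespace Literature.AlgebraicGeometry.Kawanoue2007

namespace IdealisticFiltration

variable {R : Type*} [CommRing R]

/-! ## Monomials `∏ f_λ^{n_λ}` in the generators and their weights `Σ n_λ a_λ` -/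

/-- `∏_λ f_λ^{n_λ}` for a finitely supported exponent vector `n` on `R × ℝ` (indexing the pairs
`(f_λ, a_λ)`). [cite: Kawanoue2007, Lemma 2.2.1.2 (1)] -/
noncomputable def monomialOf (n : (R × ℝ) →₀ ℕ) : R := n.prod fun x k => x.1 ^ k

/-- `Σ_λ n_λ a_λ`. [cite: Kawanoue2007, Lemma 2.2.1.2 (1)] -/
noncomputable def weightOf (n : (R × ℝ) →₀ ℕ) : ℝ := n.sum fun x k => (k : ℝ) * x.2

/-- The empty product is `1`. [cite: Kawanoue2007, Lemma 2.2.1.2 (1)] -/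
@[simp] theorem monomialOf_zero : monomialOf (0 : (R × ℝ) →₀ ℕ) = 1 := Finsupp.prod_zero_index

omit [CommRing R] in
/-- The empty sum is `0`. [cite: Kawanoue2007, Lemma 2.2.1.2 (1)] -/
@[simp] theorem weightOf_zero : weightOf (0 : (R × ℝ) →₀ ℕ) = 0 := Finsupp.sum_zero_index

/-- `∏ f^{n+n'} = ∏ f^{n} · ∏ f^{n'}`. [cite: Kawanoue2007, Lemma 2.2.1.2 (1)] -/
theorem monomialOf_add (n n' : (R × ℝ) →₀ ℕ) : monomialOf (n + n') = monomialOf n * monomialOf n' :=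
  Finsupp.prod_add_index' (fun _ => pow_zero _) fun _ _ _ => pow_add _ _ _

omit [CommRing R] in
/-- `Σ (n+n') a = Σ n a + Σ n' a`. [cite: Kawanoue2007, Lemma 2.2.1.2 (1)] -/
theorem weightOf_add (n n' : (R × ℝ) →₀ ℕ) : weightOf (n + n') = weightOf n + weightOf n' :=
  Finsupp.sum_add_index' (fun _ => by simp) fun _ _ _ => by push_cast; ring

/-- The monomial of the single exponent `(f, a) ↦ 1` is `f`. [cite: Kawanoue2007, Lemma 2.2.1.2 (1)] -/
@[simp] theorem monomialOf_single_one (x : R × ℝ) : monomialOf (Finsupp.single x 1) = x.1 := by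
  unfold monomialOf
  rw [Finsupp.prod_single_index (by simp)]
  exact pow_one _

omit [CommRing R] in
/-- … and its weight is `a`. [cite: Kawanoue2007, Lemma 2.2.1.2 (1)] -/
@[simp] theorem weightOf_single_one (x : R × ℝ) : weightOf (Finsupp.single x 1) = x.2 := by
  rw [weightOf, Finsupp.sum_single_index (by simp)]; simp

/-- A product `∏_{x ∈ s} f_x^{k_x}` of powers of elements `f_x ∈ 𝕀_{a_x}` lies in `𝕀_{Σ k_x a_x}`
(conditions (o), (ii)). [cite: Kawanoue2007, Rem. 2.1.1.2 (1) (o)(ii)] -/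
theorem prod_pow_mem_level_sum (𝕀 : IdealisticFiltration R) (k : R × ℝ → ℕ) (s : Finset (R × ℝ))
    (h : ∀ x ∈ s, x.1 ∈ 𝕀.level x.2) :
    ∏ x ∈ s, x.1 ^ k x ∈ 𝕀.level (∑ x ∈ s, (k x : ℝ) * x.2) := by
  classical
  induction s using Finset.induction_on with
  | empty => simpa using 𝕀.mem_level_zero 1
  | insert x s hx ih =>
    rw [Finset.prod_insert hx, Finset.sum_insert hx]
    exact 𝕀.mul_mem (𝕀.pow_mem (h x (Finset.mem_insert_self x s)) (k x))
      (ih fun y hy => h y (Finset.mem_insert_of_mem hy))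

/-- `∏ f_λ^{n_λ} ∈ 𝕀_{Σ n_λ a_λ}` whenever all `(f_λ, a_λ) ∈ 𝕀`. [cite: Kawanoue2007, Lemma 2.2.1.2 (1)] -/
theorem monomialOf_mem_level_weightOf (𝕀 : IdealisticFiltration R) (n : (R × ℝ) →₀ ℕ)
    (h : ∀ x ∈ n.support, x.1 ∈ 𝕀.level x.2) : monomialOf n ∈ 𝕀.level (weightOf n) :=
  prod_pow_mem_level_sum 𝕀 n n.support h

/-! ## Lemma 2.2.1.2 (1): `𝕀'` and `𝕀' = G(T)` -/

/-- The printed generating set of `𝕀'_a`: `{ ∏ f_λ^{n_λ} ; n_λ ∈ ℤ_{≥0}, Σ n_λ a_λ ≥ a }`, the products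
running over exponent vectors supported in `T`. [cite: Kawanoue2007, Lemma 2.2.1.2 (1)] -/
def genMonomials (T : Set (R × ℝ)) (a : ℝ) : Set R :=
  {g | ∃ n : (R × ℝ) →₀ ℕ, ↑n.support ⊆ T ∧ a ≤ weightOf n ∧ monomialOf n = g}

/-- `genMonomials T` is antitone in the level. [cite: Kawanoue2007, Lemma 2.2.1.2 (1)] -/
theorem genMonomials_mono (T : Set (R × ℝ)) {a b : ℝ} (hba : b ≤ a) :
    genMonomials T a ⊆ genMonomials T b :=
  fun _ ⟨n, hn, ha, hg⟩ => ⟨n, hn, hba.trans ha, hg⟩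

/-- `1 ∈ genMonomials T a` for `a ≤ 0` (the empty product). [cite: Kawanoue2007, Lemma 2.2.1.2 (1)] -/
theorem one_mem_genMonomials (T : Set (R × ℝ)) {a : ℝ} (ha : a ≤ 0) : (1 : R) ∈ genMonomials T a :=
  ⟨0, by simp, by simpa using ha, monomialOf_zero⟩

/-- `f ∈ genMonomials T a` for `(f, a) ∈ T`. [cite: Kawanoue2007, Lemma 2.2.1.2 (1)] -/
theorem mem_genMonomials_of_mem {T : Set (R × ℝ)} {f : R} {a : ℝ} (h : (f, a) ∈ T) :
    f ∈ genMonomials T a := by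
  refine ⟨Finsupp.single (f, a) 1, ?_, by simp, by simp⟩
  intro x hx
  rw [Finset.mem_coe, Finsupp.mem_support_single] at hx
  rw [hx.1]; exact h

/-- Products: `genMonomials T a · genMonomials T b ⊆ genMonomials T (a + b)` (add the exponent
vectors). [cite: Kawanoue2007, Lemma 2.2.1.2 (1)] -/
theorem mul_mem_genMonomials {T : Set (R × ℝ)} {a b : ℝ} {g g' : R} (hg : g ∈ genMonomials T a)
    (hg' : g' ∈ genMonomials T b) : g * g' ∈ genMonomials T (a + b) := by
  classical
  obtain ⟨n, hn, ha, rfl⟩ := hg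
  obtain ⟨n', hn', hb, rfl⟩ := hg'
  refine ⟨n + n', ?_, ?_, monomialOf_add n n'⟩
  · intro x hx
    have hx' := Finsupp.support_add (Finset.mem_coe.mp hx)
    rw [Finset.mem_union] at hx'
    exact hx'.elim (fun h => hn (Finset.mem_coe.mpr h)) fun h => hn' (Finset.mem_coe.mpr h)
  · rw [weightOf_add]; exact add_le_add ha hb

/-- **`𝕀'` of Lemma 2.2.1.2 (1)**: `𝕀'_a` = the ideal generated by the monomials `∏ f_λ^{n_λ}` with
`Σ n_λ a_λ ≥ a` — «Then `𝕀'` is an idealistic filtration». [cite: Kawanoue2007, Lemma 2.2.1.2 (1)] -/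
def generate' (T : Set (R × ℝ)) : IdealisticFiltration R where
  level a := Ideal.span (genMonomials T a)
  level_zero := eq_top_iff.mpr fun f _ =>
    by simpa using Ideal.mul_mem_left _ f (Ideal.subset_span (one_mem_genMonomials T le_rfl))
  mul_le a b := by
    rw [Ideal.span_mul_span']
    refine Ideal.span_mono ?_
    rintro _ ⟨g, hg, g', hg', rfl⟩
    exact mul_mem_genMonomials hg hg'
  antitone a b hab := Ideal.span_mono (genMonomials_mono T hab)

/-- The levels of `𝕀'`. [cite: Kawanoue2007, Lemma 2.2.1.2 (1)] -/
theorem level_generate' (T : Set (R × ℝ)) (a : ℝ) :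
    (generate' T).level a = Ideal.span (genMonomials T a) := rfl

/-- `T ⊂ 𝕀'`. [cite: Kawanoue2007, Lemma 2.2.1.2 (1)] -/
theorem subset_carrier_generate' (T : Set (R × ℝ)) : T ⊆ (generate' T).carrier :=
  fun ⟨_, _⟩ h => Ideal.subset_span (mem_genMonomials_of_mem h)

/-- `𝕀' ⊂ 𝕀` for every idealistic filtration `𝕀 ⊃ T` (each monomial lies in `𝕀` by (o), (ii), (iii)).
[cite: Kawanoue2007, Lemma 2.2.1.2 (1)] -/
theorem generate'_incl {T : Set (R × ℝ)} {𝕀 : IdealisticFiltration R} (hT : T ⊆ 𝕀.carrier) :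
    Incl (generate' T) 𝕀 := by
  intro a
  rw [level_generate', Ideal.span_le]
  rintro _ ⟨n, hn, ha, rfl⟩
  exact 𝕀.mem_of_le ha (monomialOf_mem_level_weightOf 𝕀 n fun x hx => hT (hn (Finset.mem_coe.mpr hx)))

/-- **Lemma 2.2.1.2 (1): `𝕀' = G(T)`.** [cite: Kawanoue2007, Lemma 2.2.1.2 (1)] -/
theorem generate'_eq_generate (T : Set (R × ℝ)) : generate' T = generate T :=
  Incl.antisymm (generate'_incl (subset_carrier_generate T)) (generate_incl (subset_carrier_generate' T))

/-- **Lemma 2.2.1.2 (1), levelwise**: `G(T)_a = ( ∏ f_λ^{n_λ} ; Σ n_λ a_λ ≥ a )`.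
[cite: Kawanoue2007, Lemma 2.2.1.2 (1)] -/
theorem level_generate_eq_span (T : Set (R × ℝ)) (a : ℝ) :
    (generate T).level a = Ideal.span (genMonomials T a) := by
  rw [← generate'_eq_generate]; rfl

/-- In particular each monomial `∏ f_λ^{n_λ}` with `Σ n_λ a_λ ≥ a` lies in `G(T)_a`.
[cite: Kawanoue2007, Lemma 2.2.1.2 (1)] -/
theorem monomialOf_mem_level_generate {T : Set (R × ℝ)} {a : ℝ} {n : (R × ℝ) →₀ ℕ}
    (hn : ↑n.support ⊆ T) (ha : a ≤ weightOf n) : monomialOf n ∈ (generate T).level a := by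
  rw [level_generate_eq_span]
  exact Ideal.subset_span ⟨n, hn, ha, rfl⟩

/-- `G(∅)_a = 0` for `a > 0` (and `= R` for `a ≤ 0`, `level_eq_top_of_nonpos`): the only monomial
supported in `∅` is the empty product, of weight `0`. [cite: Kawanoue2007, Lemma 2.2.1.2 (1)] -/
theorem level_generate_empty_of_pos {a : ℝ} (ha : 0 < a) :
    (generate (∅ : Set (R × ℝ))).level a = ⊥ := by
  rw [level_generate_eq_span, Ideal.span_eq_bot]
  rintro _ ⟨n, hn, ha', rfl⟩
  have h0 : n = 0 := by
    rw [← Finsupp.support_eq_empty, ← Finset.coe_eq_empty]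
    exact Set.subset_empty_iff.mp hn
  subst h0
  rw [weightOf_zero] at ha'
  exact absurd ha' (not_le.mpr ha)

end IdealisticFiltration

end Literature.AlgebraicGeometry.Kawanoue2007
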